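import Mathlib
import Summits.NavierStokesRegularity.FluidComputer.TransportGalerkinWeights
import HarnessLib

/-!
# Certificate weights «head block ⊕ diagonal tail» on the phase space `E` (instab g18, cell `ns-blowup`, 2026-08-27)

HONEST FRAMING (human ruling D-0035): nothing here is a claim about Navier–Stokes blow-up.
WHAT THIS IS NOT: not NS evidence — plumbing for the users of the (β2) KEEP/KILL schema at shifted
levels (`TransportGalerkinShift` / `TransportGalerkinAbcShift`, `HOME/instab/BETA2-SPEC.md` §11). A
certificate weight of the cell's format is `G = P_K ∘ H ∘ P_K + D`, with `H : E →L[ℝ] E` any bounded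
real-linear map (the dense head block, read on the cube `|k|_∞ ≤ K`) and `D` a diagonal multiplier
(the tail; `TransportGalerkinWeights.exists_diagCLM`). For such `G` (stated through the hypothesis
`hG : ∀ w, G w = P_K (H (P_K w)) + D w`, general finite `d`, Hilbert `V`):

* `headTail_compat` — `G` is `cubeProj (n + K)`-compatible for EVERY `n` (the hypotheses hG₁P/hG₂P/hGP
  of `half_prediction_nsField_shift K`);
* `headTail_symm` — `G` is symmetric when `H` is;
* `headTail_coe_of_cubeProj_eq_zero` — on vectors killed by `P_K`, `G` acts diagonally with the tail
  symbol (the hypothesis of `TransportGalerkinWeights.tail_ineq_of_symbol_ineq`);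
* `re_inner_headTail_self` — `Re⟪G x, x⟫ = Re⟪H (P_K x), P_K x⟫ + ∑_k g(k)‖x k‖²`;
* `re_inner_cubeProj_self` — `Re⟪P_K x, x⟫ = ∑_{k ∈ cube K} ‖x k‖²` (`P_K` is the diagonal multiplier
  with the cube's indicator as symbol), `norm_sq_eq_tsum` — `‖x‖² = ∑_k ‖x k‖²`;
* `headTail_lower` / `headTail_upper` — the comparison constants of the schema (`m‖x‖² ≤ Re⟪Gx,x⟫ ≤ M‖x‖²`)
  from a head bound `m_h‖p‖² ≤ Re⟪H p, p⟫ ≤ M_h‖p‖²` on `p = P_K x` and pointwise tail bounds.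

Mathlib + the tree files cited; no new definitions.
-/

noncomputable section

namespace Summit.NavierStokesRegularity.FluidComputer.TransportGalerkinHeadTail

open Set Filter Topology Finset RCLike
open Literature.Analysis.FunctionSpaces Literature.Analysis.FunctionSpaces.Lattice
open Literature.Analysis.FunctionSpaces.Torus Literature.Analysis.ODE
open Summit.NavierStokesRegularity.FluidComputer.GalerkinLatticePhaseSpace
open Summit.NavierStokesRegularity.FluidComputer.TransportGalerkin
open Summit.NavierStokesRegularity.FluidComputer.TransportGalerkinBox
open Summit.NavierStokesRegularity.FluidComputer.TransportGalerkinWeights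
open scoped ENNReal NNReal ComplexConjugate InnerProductSpace

variable {d : Type*} [Fintype d] [DecidableEq d]
variable {V : Type*} [NormedAddCommGroup V] [InnerProductSpace ℂ V] [CompleteSpace V]
variable {K : ℕ} {H D G : lp (fun _ : (d → ℤ) => V) 2 →L[ℝ] lp (fun _ : (d → ℤ) => V) 2} {g : (d → ℤ) → ℝ}

omit [CompleteSpace V] in
/-- `P_K` is symmetric (the cube instance of `inner_lpProj_left_eq_right`). -/
theorem inner_cubeProj_left (K : ℕ) (f z : lp (fun _ : (d → ℤ) => V) 2) :
    ⟪cubeProj K f, z⟫_ℂ = ⟪f, cubeProj K z⟫_ℂ := by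
  rw [cubeProj_eq]; exact inner_lpProj_left_eq_right _ f z

omit [CompleteSpace V] in
/-- **A head∣tail weight is `cubeProj (n + K)`-compatible for every level `n`.** -/
theorem headTail_compat (hG : ∀ w, G w = cubeProj K (H (cubeProj K w)) + D w)
    (hD : ∀ z, ⇑(D z) = fun k => (g k : ℂ) • z k) (n : ℕ) (w z : lp (fun _ : (d → ℤ) => V) 2) :
    ⟪G w, cubeProj (n + K) z⟫_ℂ = ⟪G (cubeProj (n + K) w), z⟫_ℂ := by
  have hKn : K ≤ n + K := by omega
  rw [hG, hG, inner_add_left, inner_add_left, diag_cubeProj_comm hD (n + K) w z]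
  congr 1
  rw [← inner_cubeProj_left, lpProj_cube_nested_ge hKn, lpProj_cube_nested_le hKn]

omit [DecidableEq d] [CompleteSpace V] in
/-- **A head∣tail weight is symmetric when the head block is.** -/
theorem headTail_symm [DecidableEq d] (hG : ∀ w, G w = cubeProj K (H (cubeProj K w)) + D w)
    (hD : ∀ z, ⇑(D z) = fun k => (g k : ℂ) • z k)
    (hH : ∀ x y : lp (fun _ : (d → ℤ) => V) 2, ⟪H x, y⟫_ℂ = ⟪x, H y⟫_ℂ) (x y : lp (fun _ : (d → ℤ) => V) 2) :
    ⟪G x, y⟫_ℂ = ⟪x, G y⟫_ℂ := by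
  rw [hG, hG, inner_add_left, inner_add_right, diag_symm hD x y, inner_cubeProj_left, hH,
    ← inner_cubeProj_left]

omit [CompleteSpace V] in
/-- **On vectors killed by `P_K` a head∣tail weight acts diagonally with the tail symbol.** -/
theorem headTail_coe_of_cubeProj_eq_zero (hG : ∀ w, G w = cubeProj K (H (cubeProj K w)) + D w)
    (hD : ∀ z, ⇑(D z) = fun k => (g k : ℂ) • z k) (q : lp (fun _ : (d → ℤ) => V) 2) (hq : cubeProj K q = 0) :
    ⇑(G q) = fun k => (g k : ℂ) • q k := by
  rw [hG, hq, map_zero, map_zero, zero_add, hD]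

omit [Fintype d] [DecidableEq d] [InnerProductSpace ℂ V] [CompleteSpace V] in
/-- `‖x‖² = ∑_k ‖x k‖²` in `E`. -/
theorem norm_sq_eq_tsum (x : lp (fun _ : (d → ℤ) => V) 2) : ‖x‖ ^ 2 = ∑' k, ‖x k‖ ^ 2 := by
  have := lp.hasSum_norm (by norm_num : 0 < (2 : ℝ≥0∞).toReal) x
  have h2 : HasSum (fun k => ‖x k‖ ^ 2) (‖x‖ ^ 2) := by simpa using this
  exact h2.tsum_eq.symm

omit [CompleteSpace V] in
/-- `P_K` acts diagonally with the cube's indicator as symbol. -/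
theorem coe_cubeProj_eq_indicator (K : ℕ) (z : lp (fun _ : (d → ℤ) => V) 2) :
    ⇑(cubeProj K z) = fun k =>
      ((if k ∈ Fintype.piFinset (fun _ : d => Finset.Icc (-(K : ℤ)) K) then (1 : ℝ) else 0 : ℝ) : ℂ) • z k := by
  funext k
  rw [cubeProj_apply]
  split_ifs <;> simp

omit [CompleteSpace V] in
/-- **`Re⟪P_K x, x⟫ = ∑_k 𝟙_{cube K}(k)‖x k‖²`.** -/
theorem re_inner_cubeProj_self (K : ℕ) (x : lp (fun _ : (d → ℤ) => V) 2) :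
    re ⟪cubeProj K x, x⟫_ℂ =
      ∑' k, (if k ∈ Fintype.piFinset (fun _ : d => Finset.Icc (-(K : ℤ)) K) then (1 : ℝ) else 0) * ‖x k‖ ^ 2 :=
  re_inner_eq_tsum_of_coe (coe_cubeProj_eq_indicator K x) (M := 1) fun k => by split_ifs <;> simp

omit [CompleteSpace V] in
/-- **The quadratic form of a head∣tail weight**: `Re⟪G x, x⟫ = Re⟪H (P_K x), P_K x⟫ + ∑_k g(k)‖x k‖²`. -/
theorem re_inner_headTail_self (hG : ∀ w, G w = cubeProj K (H (cubeProj K w)) + D w)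
    (hD : ∀ z, ⇑(D z) = fun k => (g k : ℂ) • z k) {Mg : ℝ} (hg : ∀ k, |g k| ≤ Mg) (x : lp (fun _ : (d → ℤ) => V) 2) :
    re ⟪G x, x⟫_ℂ = re ⟪H (cubeProj K x), cubeProj K x⟫_ℂ + ∑' k, g k * ‖x k‖ ^ 2 := by
  rw [hG, inner_add_left, map_add, inner_cubeProj_left, re_inner_diag_self_eq_tsum hD hg]

omit [CompleteSpace V] in
/-- **Lower comparison constant of a head∣tail weight**: if `m_h‖p‖² ≤ Re⟪H p, p⟫` for `p = P_K x`,
`m ≤ m_h + g(k)` on the cube and `m ≤ g(k)` off it, then `m‖x‖² ≤ Re⟪G x, x⟫`. -/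
theorem headTail_lower (hG : ∀ w, G w = cubeProj K (H (cubeProj K w)) + D w)
    (hD : ∀ z, ⇑(D z) = fun k => (g k : ℂ) • z k) {Mg : ℝ} (hg : ∀ k, |g k| ≤ Mg) {mh m : ℝ}
    (hH : ∀ x : lp (fun _ : (d → ℤ) => V) 2, mh * ‖cubeProj K x‖ ^ 2 ≤ re ⟪H (cubeProj K x), cubeProj K x⟫_ℂ)
    (hhead : ∀ k, k ∈ Fintype.piFinset (fun _ : d => Finset.Icc (-(K : ℤ)) K) → m ≤ mh + g k)
    (htail : ∀ k, k ∉ Fintype.piFinset (fun _ : d => Finset.Icc (-(K : ℤ)) K) → m ≤ g k)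
    (x : lp (fun _ : (d → ℤ) => V) 2) : m * ‖x‖ ^ 2 ≤ re ⟪G x, x⟫_ℂ := by
  have hind : ∀ k, |(if k ∈ Fintype.piFinset (fun _ : d => Finset.Icc (-(K : ℤ)) K) then (1 : ℝ) else 0)| ≤ 1 :=
    fun k => by split_ifs <;> simp
  have hPK : ‖cubeProj K x‖ ^ 2 =
      ∑' k, (if k ∈ Fintype.piFinset (fun _ : d => Finset.Icc (-(K : ℤ)) K) then (1 : ℝ) else 0) * ‖x k‖ ^ 2 := by
    rw [← re_inner_cubeProj_self]
    have h := inner_cubeProj_left K (cubeProj K x) x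
    rw [cubeProj_eq, lpProj_idem, ← cubeProj_eq] at h
    rw [h]
    exact (inner_self_eq_norm_sq (𝕜 := ℂ) _).symm
  have hs1 := summable_symbol_mul_norm_sq hind x
  have hsg := summable_symbol_mul_norm_sq hg x
  have hs0 : Summable fun k => ‖x k‖ ^ 2 := by
    have := lp.hasSum_norm (by norm_num : 0 < (2 : ℝ≥0∞).toReal) x
    have h2 : HasSum (fun k => ‖x k‖ ^ 2) (‖x‖ ^ 2) := by simpa using this
    exact h2.summable
  rw [re_inner_headTail_self hG hD hg, norm_sq_eq_tsum]
  refine le_trans ?_ (add_le_add (hH x) le_rfl)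
  rw [hPK, ← tsum_mul_left, ← tsum_mul_left, ← (hs1.mul_left mh).tsum_add hsg]
  refine Summable.tsum_le_tsum (fun k => ?_) (hs0.mul_left m) ((hs1.mul_left mh).add hsg)
  by_cases hk : k ∈ Fintype.piFinset (fun _ : d => Finset.Icc (-(K : ℤ)) K)
  · have e : mh * ((1 : ℝ) * ‖x k‖ ^ 2) + g k * ‖x k‖ ^ 2 = (mh + g k) * ‖x k‖ ^ 2 := by ring
    simp only [if_pos hk]
    exact (mul_le_mul_of_nonneg_right (hhead k hk) (sq_nonneg ‖x k‖)).trans_eq e.symm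
  · simp only [if_neg hk, zero_mul, mul_zero, zero_add]
    exact mul_le_mul_of_nonneg_right (htail k hk) (sq_nonneg ‖x k‖)

omit [CompleteSpace V] in
/-- **Upper comparison constant of a head∣tail weight**: if `Re⟪H p, p⟫ ≤ M_h‖p‖²` for `p = P_K x`,
`M_h + g(k) ≤ M` on the cube and `g(k) ≤ M` off it, then `Re⟪G x, x⟫ ≤ M‖x‖²`. -/
theorem headTail_upper (hG : ∀ w, G w = cubeProj K (H (cubeProj K w)) + D w)
    (hD : ∀ z, ⇑(D z) = fun k => (g k : ℂ) • z k) {Mg : ℝ} (hg : ∀ k, |g k| ≤ Mg) {Mh M : ℝ}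
    (hH : ∀ x : lp (fun _ : (d → ℤ) => V) 2, re ⟪H (cubeProj K x), cubeProj K x⟫_ℂ ≤ Mh * ‖cubeProj K x‖ ^ 2)
    (hhead : ∀ k, k ∈ Fintype.piFinset (fun _ : d => Finset.Icc (-(K : ℤ)) K) → Mh + g k ≤ M)
    (htail : ∀ k, k ∉ Fintype.piFinset (fun _ : d => Finset.Icc (-(K : ℤ)) K) → g k ≤ M)
    (x : lp (fun _ : (d → ℤ) => V) 2) : re ⟪G x, x⟫_ℂ ≤ M * ‖x‖ ^ 2 := by
  have hind : ∀ k, |(if k ∈ Fintype.piFinset (fun _ : d => Finset.Icc (-(K : ℤ)) K) then (1 : ℝ) else 0)| ≤ 1 :=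
    fun k => by split_ifs <;> simp
  have hPK : ‖cubeProj K x‖ ^ 2 =
      ∑' k, (if k ∈ Fintype.piFinset (fun _ : d => Finset.Icc (-(K : ℤ)) K) then (1 : ℝ) else 0) * ‖x k‖ ^ 2 := by
    rw [← re_inner_cubeProj_self]
    have h := inner_cubeProj_left K (cubeProj K x) x
    rw [cubeProj_eq, lpProj_idem, ← cubeProj_eq] at h
    rw [h]
    exact (inner_self_eq_norm_sq (𝕜 := ℂ) _).symm
  have hs1 := summable_symbol_mul_norm_sq hind x
  have hsg := summable_symbol_mul_norm_sq hg x
  have hs0 : Summable fun k => ‖x k‖ ^ 2 := by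
    have := lp.hasSum_norm (by norm_num : 0 < (2 : ℝ≥0∞).toReal) x
    have h2 : HasSum (fun k => ‖x k‖ ^ 2) (‖x‖ ^ 2) := by simpa using this
    exact h2.summable
  rw [re_inner_headTail_self hG hD hg, norm_sq_eq_tsum]
  refine le_trans (add_le_add (hH x) le_rfl) ?_
  rw [hPK, ← tsum_mul_left, ← tsum_mul_left, ← (hs1.mul_left Mh).tsum_add hsg]
  refine Summable.tsum_le_tsum (fun k => ?_) ((hs1.mul_left Mh).add hsg) (hs0.mul_left M)
  by_cases hk : k ∈ Fintype.piFinset (fun _ : d => Finset.Icc (-(K : ℤ)) K)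
  · have e : Mh * ((1 : ℝ) * ‖x k‖ ^ 2) + g k * ‖x k‖ ^ 2 = (Mh + g k) * ‖x k‖ ^ 2 := by ring
    simp only [if_pos hk]
    exact e.trans_le (mul_le_mul_of_nonneg_right (hhead k hk) (sq_nonneg ‖x k‖))
  · simp only [if_neg hk, zero_mul, mul_zero, zero_add]
    exact mul_le_mul_of_nonneg_right (htail k hk) (sq_nonneg ‖x k‖)


/-! ## Appendix (v2): the weighted comparison constant `M₁` -/

omit [Fintype d] [DecidableEq d] [InnerProductSpace ℂ V] [CompleteSpace V] in
/-- `‖⇑x‖²_{−1}` as a real series: `(eNormSq (−1) ⇑x).toReal = ∑_k ⟨k⟩⁻²‖x k‖²`. -/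
theorem toReal_eNormSq_neg_one_eq_tsum [Fintype d] (x : lp (fun _ : (d → ℤ) => V) 2) :
    (eNormSq (-1) (⇑x)).toReal = ∑' k, sobolevWeight (-1) k ^ 2 * ‖x k‖ ^ 2 := by
  rw [eNormSq, ENNReal.tsum_toReal_eq fun k => ENNReal.mul_ne_top ENNReal.ofReal_ne_top
    (ENNReal.pow_ne_top enorm_ne_top)]
  exact tsum_congr fun k => toReal_term (-1) (⇑x) k

omit [CompleteSpace V] in
/-- **The weighted comparison constant `M₁` of a head∣tail weight** (hypothesis `hM₁'` of the schema:
`Re⟪G₁ x, x⟫ ≤ M₁·‖⇑x‖²_{−1}`): if `Re⟪H p, p⟫ ≤ M_h‖p‖²` for `p = P_K x`, `M_h + g(k) ≤ M₁⟨k⟩⁻²` on the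
cube and `g(k) ≤ M₁⟨k⟩⁻²` off it, then `Re⟪G x, x⟫ ≤ M₁·(eNormSq (−1) ⇑x).toReal`. -/
theorem headTail_upper_weighted (hG : ∀ w, G w = cubeProj K (H (cubeProj K w)) + D w)
    (hD : ∀ z, ⇑(D z) = fun k => (g k : ℂ) • z k) {Mg : ℝ} (hg : ∀ k, |g k| ≤ Mg) {Mh M₁ : ℝ}
    (hH : ∀ x : lp (fun _ : (d → ℤ) => V) 2, re ⟪H (cubeProj K x), cubeProj K x⟫_ℂ ≤ Mh * ‖cubeProj K x‖ ^ 2)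
    (hhead : ∀ k, k ∈ Fintype.piFinset (fun _ : d => Finset.Icc (-(K : ℤ)) K) → Mh + g k ≤ M₁ * sobolevWeight (-1) k ^ 2)
    (htail : ∀ k, k ∉ Fintype.piFinset (fun _ : d => Finset.Icc (-(K : ℤ)) K) → g k ≤ M₁ * sobolevWeight (-1) k ^ 2)
    (x : lp (fun _ : (d → ℤ) => V) 2) : re ⟪G x, x⟫_ℂ ≤ M₁ * (eNormSq (-1) (⇑x)).toReal := by
  have hind : ∀ k, |(if k ∈ Fintype.piFinset (fun _ : d => Finset.Icc (-(K : ℤ)) K) then (1 : ℝ) else 0)| ≤ 1 :=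
    fun k => by split_ifs <;> simp
  have hw : ∀ k : d → ℤ, |M₁ * sobolevWeight (-1) k ^ 2| ≤ |M₁| := fun k => by
    rw [abs_mul, abs_of_nonneg (sq_nonneg (sobolevWeight (-1) k))]
    refine mul_le_of_le_one_right (abs_nonneg _) ?_
    have h1 := sobolevWeight_le_one (by norm_num : (-1 : ℝ) ≤ 0) k
    have h0 := (sobolevWeight_pos (-1) k).le
    nlinarith
  have hPK : ‖cubeProj K x‖ ^ 2 =
      ∑' k, (if k ∈ Fintype.piFinset (fun _ : d => Finset.Icc (-(K : ℤ)) K) then (1 : ℝ) else 0) * ‖x k‖ ^ 2 := by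
    rw [← re_inner_cubeProj_self]
    have h := inner_cubeProj_left K (cubeProj K x) x
    rw [cubeProj_eq, lpProj_idem, ← cubeProj_eq] at h
    rw [h]
    exact (inner_self_eq_norm_sq (𝕜 := ℂ) _).symm
  have hs1 := summable_symbol_mul_norm_sq hind x
  have hsg := summable_symbol_mul_norm_sq hg x
  have hsw := summable_symbol_mul_norm_sq hw x
  rw [re_inner_headTail_self hG hD hg, toReal_eNormSq_neg_one_eq_tsum, ← tsum_mul_left]
  refine le_trans (add_le_add (hH x) le_rfl) ?_
  rw [hPK, ← tsum_mul_left, ← (hs1.mul_left Mh).tsum_add hsg]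
  have hsw' : Summable fun k => M₁ * (sobolevWeight (-1) k ^ 2 * ‖x k‖ ^ 2) :=
    hsw.congr fun k => by ring
  refine Summable.tsum_le_tsum (fun k => ?_) ((hs1.mul_left Mh).add hsg) hsw'
  by_cases hk : k ∈ Fintype.piFinset (fun _ : d => Finset.Icc (-(K : ℤ)) K)
  · have e : Mh * ((1 : ℝ) * ‖x k‖ ^ 2) + g k * ‖x k‖ ^ 2 = (Mh + g k) * ‖x k‖ ^ 2 := by ring
    have e' : M₁ * (sobolevWeight (-1) k ^ 2 * ‖x k‖ ^ 2) = (M₁ * sobolevWeight (-1) k ^ 2) * ‖x k‖ ^ 2 := by ring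
    simp only [if_pos hk]
    exact e.trans_le ((mul_le_mul_of_nonneg_right (hhead k hk) (sq_nonneg ‖x k‖)).trans_eq e'.symm)
  · have e' : M₁ * (sobolevWeight (-1) k ^ 2 * ‖x k‖ ^ 2) = (M₁ * sobolevWeight (-1) k ^ 2) * ‖x k‖ ^ 2 := by ring
    simp only [if_neg hk, zero_mul, mul_zero, zero_add]
    exact (mul_le_mul_of_nonneg_right (htail k hk) (sq_nonneg ‖x k‖)).trans_eq e'.symm

end Summit.NavierStokesRegularity.FluidComputer.TransportGalerkinHeadTail

end
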